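import Summits.QuantumFields.YangMills.Theorems.LuscherReductionTwistedTraceScalingBOCentralTube
import Summits.QuantumFields.YangMills.Theorems.TwistedTraceScaling.Negative.CentralGlueCoSupport
import HarnessLib

/-!
# Negative lemma R46 (cdisprove g38) — the RADIUS WINDOW of the central Gaussian comparison (C1c′)/(C1d)
# (crux `TwistedTraceScaling` stmt-QuantumFields-20203, skeleton «twolattice»; vets lane A's `…BOCentralGaussian` (p684724), `…BOCentralChart`, `…BOCentralTube`)

Lane A's (OD)-pen design point (COARSE-DESIGN §27.8–§27.9, `…BOCentralTube`): feed the (C1) glue with `G := A_W(χ₀⊗Ω)` itself and prove (C1d) by a Laplace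
evaluation on the chart polydisc `{w | ∀ e, Σ_a w_e a² ≤ ρ²}`; the only analytic input left is (C1c′): `g₋·e^{−q(chartVec w)} ≤ A(P w)` on the part
`‖chartVec w‖ ≤ R₁` of the polydisc and `A(P w) ≤ g₊·e^{−q(chartVec w)}` on all of it (`q = stiffGaussExp L (β/2) β`, `P = latPatternChart L (fun _ => false)`).
This file records, as checked inequalities, WHERE in the parameters `(ρ, ρ′ | T, R, R₁, β, L)` those statements can be non-vacuous:

* §1 `stiffGaussTop_le_pow`: the stiff top eigenvalue is below the free Gaussian constant, `stiffGaussTop L t b ≤ √(π/b)^{9L³}`; `card_linkIndex` (`dim = 9L³`).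
* §2 ★★ VACUITY RADIUS of the (C1d) lower bounds: `top_mul_exp_le_tail` — whenever `m²b ≤ 9L³·log 2 + 2c` the Gaussian tail constant
  `e^{c}e^{−bm²/2}(π/(b/2))^{dim/2}` of `…BOCentralModel.model_integral_off_le` dominates the main term `stiffGaussTop·e^{−q(x)}` at EVERY `x`; hence the left sides of
  `…BOCentralGaussian.central_gaussian_lower` (`m = ρ−ρ′`), `…central_gaussian_lower_local` (`m = min(ρ−ρ′, R₀)`) are `≤ 0` (`central_gaussian_lower_nonpos`,
  `central_gaussian_lower_local_nonpos`), and the lower constant `m_d` of `…BOCentralTube.central_gaussian_tube_lower` / `central_transfer_two_sided_of_localisedAvg` is `≤ 0`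
  unless `min(ρ−2T, R₁−2R)²·β > 9L³log 2 + 98βR²` (`central_gaussian_tube_lower_nonpos`): the margins must exceed `β^{-1/2}·3L^{3/2}√(log 2)` (`7.06β^{-1/2}` at `L = 2`)
  and `R₁ > (2+√98)R ≈ 11.9R` — the Laplace radius is VOLUME-dependent (a threshold for S-BASE at fixed `L`, not a kill).
* §3 the two-link configuration `v₀ = a·e₀⊗(δ_{(x₁,k)} − δ_{(x₂,k)})` of `…Negative.CentralGlueCoSupport` (R45) IS a chart point: `orthoTube L 1 v₀ = P(gn∘chartSU2∘v₀)`, with per-link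
  size `Σ_a w_e a² ≤ (4/3)a²` and `‖chartVec w‖² ≤ (8/3)a²` (`twoLink_chart_mem_ball`, `twoLink_chart_norm_le`).
* §4 ★★★ `not_localGaussLower_of_twoLink` / `not_hAlo_of_sq_lt`: under the glue's support hypotheses (`Ω(linkEmbed v) ≠ 0 ⇒ |v_{e,c}| ≤ T`, `W g ≠ 0 ⇒ ‖g_x − 1‖ ≤ T`) and ANY
  pointwise lower comparison `mc·G ≤ A_W(χ₀⊗Ω)`, `mc > 0` (for `G := A`: `mc = 1`), the localised lower hypothesis `hAlo` of `…BOCentralTube` (radius `R₁`) is FALSE for every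
  `gm > 0` as soon as `R₁² > (200/3)T²` (`R₁ > 8.165T`), given lane A's own `0 < ρ ≤ 1/2`, `8T ≤ ρ`: `A` vanishes at the two-link chart point while `gm·e^{−q} > 0`.
  `not_hGlo`: the unlocalised `hGlo` of `…BOCentralGaussian` is false outright under `8T ≤ ρ ≤ 1/2`.  In particular `hAlo` is false on the schedule announced in the
  `…BOCentralTube` docstring (`T, R = O(β^{-1/2}ℓ)`, `R₁ − 2R ≥ β^{-1/2}ℓ²`, `ℓ = max(log β, 1) → ∞`, so `R₁/T → ∞`).
* §5 ★★ `window`: `hAlo` (⇒ `R₁² ≤ (200/3)T²`) together with an informative `m_d` (⇒ `(R₁−2R)²β > 9L³log 2 + 98βR²`) forces `102R² < R₁² ≤ (200/3)T²` — the declared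
  fibre-norm bound `R` must be below `0.81×` the declared component/gauge bound `T` — and `9L³log 2 < (200/3)T²β`, i.e. `T > 0.30·L^{3/2}·β^{-1/2}`.
READING (constraints on the unbuilt brick (C1c′); nothing landed is wrong): with `G := A` the comparison-from-below can only hold INSIDE the positivity region of `A`, whose
boundary in transverse directions sits at the support radius of `Ω` (`≈ r(1+o(1))`, on paper) and, rigorously (R45), at the two-link radius `√(8/3)·(3T₁+2T₂)` in `chartVec`-norm;
a localisation `R₁ ≥ 2R ≥ 2r` always contains transverse points outside `supp A` on paper, and contains the two-link zeros once `R₁ > 8.165T`.  REPAIR DIRECTION: localise `hAlo`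
to `‖chartVec w‖ ≤ R₁ < r` and take the margin from the centre's own depth (`…central_gaussian_lower_local` with `R₀ = R₁ − ‖chartVec w′‖`), covering only centres `v′` with
`‖linkEmbed v′‖ ≤ r − β^{-1/2}√(9L³log 2 + 2log((π/β)^{dim/2}/stiffGaussTop) + …)`; the annulus is then paid in `L²(w)` by the profile's own decay.
HONEST FRAMING: negative/boundary lemmas (helper, `--supports stmt-QuantumFields-20203`) about hypotheses of bricks of a stub of a child of the CONDITIONAL reduction route
R2b1; nothing here refutes or proves `TwistedTraceScaling`, S-BASE, (B-OD) or C4-CORE; not infinite volume, not a gap, not Clay. bears_on R2b1.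
-/

set_option autoImplicit false

noncomputable section

open MeasureTheory Filter Topology Real
open scoped BigOperators RealInnerProductSpace
open Literature.MathematicalPhysics.QuantumFieldTheory hiding SU2
open Literature.MathematicalPhysics.QuantumLattice

namespace Summit.QuantumFields.YangMills.Theorems.TwistedTraceScaling.Negative.R46

open Summit.QuantumFields.YangMills.Theorems.FemtoTransferGap
open Summit.QuantumFields.YangMills.Theorems.FemtoTransferGap.TwoLattice
open Summit.QuantumFields.YangMills.Theorems.FemtoTransferGap.TwoLattice.Avg
open Summit.QuantumFields.YangMills.Theorems.FemtoTransferGap.TwoLattice.ConstTube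
open Summit.QuantumFields.YangMills.Theorems.FemtoTransferGap.TwoLattice.Stiff
open Summit.QuantumFields.YangMills.Theorems.FemtoTransferGap.TwoLattice.GnChart
open Summit.QuantumFields.YangMills.Theorems.TwistedTraceScaling.Negative.R45

variable {L : ℕ} [NeZero L]

/-! ## §1 The stiff top eigenvalue is below the free Gaussian constant -/

/-- `|Edge 3 L × Fin 3| = 9L³` (the dimension of `LinkSpace L`). [folklore] -/
theorem card_linkIndex : Fintype.card (Edge 3 L × Fin 3) = 9 * L ^ 3 := by
  rw [Fintype.card_prod, show Fintype.card (Edge 3 L) = Fintype.card (Site 3 L × Fin 3) from rfl, Fintype.card_prod, Fintype.card_pi,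
    Finset.prod_const, Finset.card_univ, Fintype.card_fin, ZMod.card]
  ring

/-- `|Edge 3 L × Fin 3|·log 2 = 9L³·log 2`. [folklore] -/
theorem card_mul_log_two : (Fintype.card (Edge 3 L × Fin 3) : ℝ) * Real.log 2 = 9 * (L : ℝ) ^ 3 * Real.log 2 := by
  rw [card_linkIndex]; push_cast; ring

/-- `dim LinkSpace L = |Edge 3 L × Fin 3|`. [folklore] -/
theorem finrank_linkSpace : Module.finrank ℝ (LinkSpace L) = Fintype.card (Edge 3 L × Fin 3) := finrank_euclideanSpace

/-- Each factor of `stiffGaussTop` is at most the free one: `√(π/(a+b+√(a²+2ab))) ≤ √(π/b)` for `a ≥ 0`, `b > 0`. [folklore] -/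
theorem sqrt_pi_div_le {a b : ℝ} (ha : 0 ≤ a) (hb : 0 < b) : Real.sqrt (π / (a + b + Real.sqrt (a ^ 2 + 2 * a * b))) ≤ Real.sqrt (π / b) := by
  apply Real.sqrt_le_sqrt
  apply div_le_div_of_nonneg_left Real.pi_pos.le hb
  have := Real.sqrt_nonneg (a ^ 2 + 2 * a * b)
  linarith

/-- ★ `stiffGaussTop L t b ≤ √(π/b)^{|Edge 3 L × Fin 3|}` (`t ≥ 0`, `b > 0`): the stiff top eigenvalue is below the free Gaussian constant. [folklore] -/
theorem stiffGaussTop_le_pow {t : ℝ} (ht : 0 ≤ t) {b : ℝ} (hb : 0 < b) : stiffGaussTop L t b ≤ Real.sqrt (π / b) ^ Fintype.card (Edge 3 L × Fin 3) := by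
  unfold stiffGaussTop
  calc _ ≤ ∏ _i : Fin (Fintype.card (Edge 3 L × Fin 3)), Real.sqrt (π / b) :=
        Finset.prod_le_prod (fun i _ => Real.sqrt_nonneg _) fun i _ => sqrt_pi_div_le (smul_stiffHessian_eigenvalues_nonneg ht i) hb
    _ = _ := by rw [Finset.prod_const, Finset.card_univ, Fintype.card_fin]

/-! ## §2 ★★ Vacuity radius of the (C1d) lower bounds -/

/-- ★★ For `m²b ≤ |Edge 3 L × Fin 3|·log 2 + 2c` the Gaussian tail constant `e^{c}·e^{−bm²/2}(π/(b/2))^{dim/2}` of `…BOCentralModel.model_integral_off_le` dominates the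
main term `stiffGaussTop L t b · e^{−q_{t,b}(x)}` at EVERY point `x`. [folklore] -/
theorem top_mul_exp_le_tail {t : ℝ} (ht : 0 ≤ t) {b : ℝ} (hb : 0 < b) {m c : ℝ}
    (hm : m ^ 2 * b ≤ Fintype.card (Edge 3 L × Fin 3) * Real.log 2 + 2 * c) (x : LinkSpace L) :
    stiffGaussTop L t b * Real.exp (-stiffGaussExp L t b x) ≤
      Real.exp c * (Real.exp (-(b * m ^ 2 / 2)) * (π / (b / 2)) ^ ((Module.finrank ℝ (LinkSpace L) : ℝ) / 2)) := by
  set n := Fintype.card (Edge 3 L × Fin 3) with hn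
  have hpb : 0 < π / b := div_pos Real.pi_pos hb
  have h1 : stiffGaussTop L t b * Real.exp (-stiffGaussExp L t b x) ≤ Real.sqrt (π / b) ^ n :=
    calc _ ≤ stiffGaussTop L t b * 1 :=
          mul_le_mul_of_nonneg_left (Real.exp_le_one_iff.2 (neg_nonpos.2 (stiffGaussExp_nonneg t b x))) (stiffGaussTop_pos ht hb).le
      _ ≤ _ := by rw [mul_one]; exact stiffGaussTop_le_pow ht hb
  have h2 : (π / (b / 2)) ^ ((Module.finrank ℝ (LinkSpace L) : ℝ) / 2) = (2 : ℝ) ^ ((n : ℝ) / 2) * Real.sqrt (π / b) ^ n := by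
    rw [finrank_linkSpace, ← hn, show π / (b / 2) = 2 * (π / b) by rw [div_div_eq_mul_div]; ring, Real.mul_rpow zero_le_two hpb.le]
    congr 1
    rw [Real.sqrt_eq_rpow, ← Real.rpow_natCast, ← Real.rpow_mul hpb.le]
    congr 1; ring
  have h3 : 1 ≤ Real.exp c * (Real.exp (-(b * m ^ 2 / 2)) * (2 : ℝ) ^ ((n : ℝ) / 2)) := by
    rw [Real.rpow_def_of_pos two_pos, ← Real.exp_add, ← Real.exp_add]
    exact Real.one_le_exp (by linarith)
  calc stiffGaussTop L t b * Real.exp (-stiffGaussExp L t b x) ≤ Real.sqrt (π / b) ^ n := h1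
    _ ≤ Real.exp c * (Real.exp (-(b * m ^ 2 / 2)) * (2 : ℝ) ^ ((n : ℝ) / 2)) * Real.sqrt (π / b) ^ n :=
        le_mul_of_one_le_left (pow_nonneg (Real.sqrt_nonneg _) n) h3
    _ = _ := by rw [h2]; ring

/-- ★★ **The left side of `…BOCentralGaussian.central_gaussian_lower` is `≤ 0` — the bound is VACUOUS — unless `(ρ−ρ′)²β > 9L³·log 2`.** [folklore] -/
theorem central_gaussian_lower_nonpos {β : ℝ} (hβ : 0 < β) {ρ ρ' : ℝ} (hm : (ρ - ρ') ^ 2 * β ≤ Fintype.card (Edge 3 L × Fin 3) * Real.log 2)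
    {gm : ℝ} (hgm : 0 ≤ gm) (w' : Edge 3 L → Fin 3 → ℝ) :
    Real.exp (2 * β) ^ Fintype.card (Edge 3 L) * ((2 * π ^ 2)⁻¹ * ((1 + ρ ^ 2)⁻¹) ^ 2) ^ Fintype.card (Edge 3 L) *
          Real.exp (-(2000 * Fintype.card (Plaquette 3 L) * ρ ^ 3 * β)) * gm *
        (stiffGaussTop L (β / 2) β * Real.exp (-stiffGaussExp L (β / 2) β (chartVec w')) -
          Real.exp (-(β * (ρ - ρ') ^ 2 / 2)) * (π / (β / 2)) ^ ((Module.finrank ℝ (LinkSpace L) : ℝ) / 2)) ≤ 0 := by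
  have h := top_mul_exp_le_tail (L := L) (t := β / 2) (by positivity) hβ (m := ρ - ρ') (c := 0) (by rw [mul_zero, add_zero]; exact hm) (chartVec w')
  rw [Real.exp_zero, one_mul] at h
  exact mul_nonpos_of_nonneg_of_nonpos (by positivity) (sub_nonpos.2 h)

/-- ★★ The same for the local form `…BOCentralGaussian.central_gaussian_lower_local`: vacuous unless `min(ρ−ρ′, R₀)²β > 9L³·log 2`. [folklore] -/
theorem central_gaussian_lower_local_nonpos {β : ℝ} (hβ : 0 < β) {ρ ρ' R₀ : ℝ}
    (hm : (min (ρ - ρ') R₀) ^ 2 * β ≤ Fintype.card (Edge 3 L × Fin 3) * Real.log 2) {gm : ℝ} (hgm : 0 ≤ gm) (w' : Edge 3 L → Fin 3 → ℝ) :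
    Real.exp (2 * β) ^ Fintype.card (Edge 3 L) * ((2 * π ^ 2)⁻¹ * ((1 + ρ ^ 2)⁻¹) ^ 2) ^ Fintype.card (Edge 3 L) *
          Real.exp (-(2000 * Fintype.card (Plaquette 3 L) * ρ ^ 3 * β)) * gm *
        (stiffGaussTop L (β / 2) β * Real.exp (-stiffGaussExp L (β / 2) β (chartVec w')) -
          Real.exp (-(β * (min (ρ - ρ') R₀) ^ 2 / 2)) * (π / (β / 2)) ^ ((Module.finrank ℝ (LinkSpace L) : ℝ) / 2)) ≤ 0 := by
  have h := top_mul_exp_le_tail (L := L) (t := β / 2) (by positivity) hβ (m := min (ρ - ρ') R₀) (c := 0) (by rw [mul_zero, add_zero]; exact hm) (chartVec w')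
  rw [Real.exp_zero, one_mul] at h
  exact mul_nonpos_of_nonneg_of_nonpos (by positivity) (sub_nonpos.2 h)

/-- ★★ **The lower constant `m_d` of `…BOCentralTube.central_gaussian_tube_lower` / `central_transfer_two_sided_of_localisedAvg` is `≤ 0` unless
`min(ρ − 2T, R₁ − 2R)²·β > 9L³·log 2 + 98βR²`** (so both margins must exceed `β^{-1/2}·3L^{3/2}√(log 2)`, and `R₁ > (2 + √98)·R`). [folklore] -/
theorem central_gaussian_tube_lower_nonpos {β : ℝ} (hβ : 0 < β) {ρ T R R₁ : ℝ}
    (hm : (min (ρ - 2 * T) (R₁ - 2 * R)) ^ 2 * β ≤ Fintype.card (Edge 3 L × Fin 3) * Real.log 2 + 98 * β * R ^ 2) {gm : ℝ} (hgm : 0 ≤ gm) :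
    Real.exp (2 * β) ^ Fintype.card (Edge 3 L) * ((2 * π ^ 2)⁻¹ * ((1 + ρ ^ 2)⁻¹) ^ 2) ^ Fintype.card (Edge 3 L) *
          Real.exp (-(2000 * Fintype.card (Plaquette 3 L) * ρ ^ 3 * β)) * gm *
        (Real.exp (-(882 * β * T ^ 2 * R ^ 2)) -
          Real.exp (49 * β * R ^ 2) * (Real.exp (-(β * (min (ρ - 2 * T) (R₁ - 2 * R)) ^ 2 / 2)) * (π / (β / 2)) ^ ((Module.finrank ℝ (LinkSpace L) : ℝ) / 2)) /
            stiffGaussTop L (β / 2) β) ≤ 0 := by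
  have ht : (0 : ℝ) ≤ β / 2 := by positivity
  have hS := stiffGaussTop_pos (L := L) ht hβ
  have h := top_mul_exp_le_tail (L := L) ht hβ (m := min (ρ - 2 * T) (R₁ - 2 * R)) (c := 49 * β * R ^ 2) (by linarith) (0 : LinkSpace L)
  rw [stiffGaussExp_zero, neg_zero, Real.exp_zero, mul_one] at h
  refine mul_nonpos_of_nonneg_of_nonpos (by positivity) (sub_nonpos.2 ?_)
  rw [le_div_iff₀ hS]
  calc Real.exp (-(882 * β * T ^ 2 * R ^ 2)) * stiffGaussTop L (β / 2) β ≤ 1 * stiffGaussTop L (β / 2) β :=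
        mul_le_mul_of_nonneg_right (Real.exp_le_one_iff.2 (neg_nonpos.2 (by positivity))) hS.le
    _ ≤ _ := by rw [one_mul]; exact h

/-! ## §3 The two-link configuration of R45 is a chart point -/

-- Throughout §3–§4 the two-link vector `v₀ = a·e₀⊗(δ_{(x₁,k)} − δ_{(x₂,k)})` of R45 is spelled out as
-- `(Pi.single (x₁, k) (Pi.single (0 : Fin 3) a) - Pi.single (x₂, k) (Pi.single (0 : Fin 3) a) : Edge 3 L → Fin 3 → ℝ)`.

omit [NeZero L] in
/-- per-link size of the two-link vector: `Σ_c v₀(e)_c² ≤ a²`. [folklore] -/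
theorem twoLink_sum_sq_le {x₁ x₂ : Site 3 L} (hx : x₁ ≠ x₂) (k : Fin 3) (a : ℝ) (e : Edge 3 L) :
    ∑ c, (Pi.single (x₁, k) (Pi.single (0 : Fin 3) a) - Pi.single (x₂, k) (Pi.single (0 : Fin 3) a) : Edge 3 L → Fin 3 → ℝ) e c ^ 2 ≤ a ^ 2 := by
  rw [twoLink_apply hx k]
  split_ifs
  · exact (sum_sq_single_zero a).le
  · simp only [Pi.neg_apply, neg_sq]; exact (sum_sq_single_zero a).le
  · simpa using sq_nonneg a

/-- total size of the two-link vector: `Σ_e Σ_c v₀(e)_c² = 2a²`. [folklore] -/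
theorem twoLink_sum_sum_sq {x₁ x₂ : Site 3 L} (hx : x₁ ≠ x₂) (k : Fin 3) (a : ℝ) :
    ∑ e, ∑ c, (Pi.single (x₁, k) (Pi.single (0 : Fin 3) a) - Pi.single (x₂, k) (Pi.single (0 : Fin 3) a) : Edge 3 L → Fin 3 → ℝ) e c ^ 2 = 2 * a ^ 2 := by
  have h12 : (x₁, k) ≠ (x₂, k) := fun h => hx (congrArg Prod.fst h)
  calc ∑ e, ∑ c, (Pi.single (x₁, k) (Pi.single (0 : Fin 3) a) - Pi.single (x₂, k) (Pi.single (0 : Fin 3) a) : Edge 3 L → Fin 3 → ℝ) e c ^ 2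
      = ∑ e : Edge 3 L, ((if e = (x₁, k) then a ^ 2 else 0) + (if e = (x₂, k) then a ^ 2 else 0)) := by
        refine Finset.sum_congr rfl fun e _ => ?_
        rw [twoLink_apply hx k]
        by_cases h1 : e = (x₁, k)
        · subst h1
          rw [if_pos rfl, if_pos rfl, if_neg h12, add_zero]
          exact sum_sq_single_zero a
        · rw [if_neg h1, if_neg h1, zero_add]
          by_cases h2 : e = (x₂, k)
          · rw [if_pos h2, if_pos h2]
            simp only [Pi.neg_apply, neg_sq]
            exact sum_sq_single_zero a
          · rw [if_neg h2, if_neg h2]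
            simp
    _ = 2 * a ^ 2 := by
        rw [Finset.sum_add_distrib, Finset.sum_ite_eq', Finset.sum_ite_eq']
        simp only [Finset.mem_univ, if_true]
        ring

omit [NeZero L] in
/-- `|a| ≤ 1/2` ⇒ the per-link cap `Σ_c v₀(e)_c² ≤ 1/4`. [folklore] -/
theorem twoLink_cap {x₁ x₂ : Site 3 L} (hx : x₁ ≠ x₂) (k : Fin 3) {a : ℝ} (ha : |a| ≤ 1 / 2) (e : Edge 3 L) :
    ∑ c, (Pi.single (x₁, k) (Pi.single (0 : Fin 3) a) - Pi.single (x₂, k) (Pi.single (0 : Fin 3) a) : Edge 3 L → Fin 3 → ℝ) e c ^ 2 ≤ 1 / 4 :=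
  (twoLink_sum_sq_le hx k a e).trans (by nlinarith [abs_nonneg a, ha, sq_abs a])

omit [NeZero L] in
/-- per-link chart size of the two-link point: `Σ_c gn(chartSU2 v₀(e))_c² ≤ (4/3)·Σ_c v₀(e)_c²` (`|a| ≤ 1/2`). [folklore] -/
theorem twoLink_chart_sum_sq_le {x₁ x₂ : Site 3 L} (hx : x₁ ≠ x₂) (k : Fin 3) {a : ℝ} (ha : |a| ≤ 1 / 2) (e : Edge 3 L) :
    ∑ c, gnLink (chartSU2 ((Pi.single (x₁, k) (Pi.single (0 : Fin 3) a) - Pi.single (x₂, k) (Pi.single (0 : Fin 3) a) : Edge 3 L → Fin 3 → ℝ) e)) c ^ 2 ≤ 4 / 3 * ∑ c, (Pi.single (x₁, k) (Pi.single (0 : Fin 3) a) - Pi.single (x₂, k) (Pi.single (0 : Fin 3) a) : Edge 3 L → Fin 3 → ℝ) e c ^ 2 :=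
  sum_gnLink_chartSU2_sq_le (twoLink_cap hx k ha e)

omit [NeZero L] in
/-- ★ the two-link chart point lies in the chart polydisc of radius `ρ` as soon as `(4/3)a² ≤ ρ²` (`|a| ≤ 1/2`). [folklore] -/
theorem twoLink_chart_mem_ball {x₁ x₂ : Site 3 L} (hx : x₁ ≠ x₂) (k : Fin 3) {a : ℝ} (ha : |a| ≤ 1 / 2) {ρ : ℝ} (hρ : 4 / 3 * a ^ 2 ≤ ρ ^ 2) (e : Edge 3 L) :
    ∑ c, gnLink (chartSU2 ((Pi.single (x₁, k) (Pi.single (0 : Fin 3) a) - Pi.single (x₂, k) (Pi.single (0 : Fin 3) a) : Edge 3 L → Fin 3 → ℝ) e)) c ^ 2 ≤ ρ ^ 2 :=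
  (twoLink_chart_sum_sq_le hx k ha e).trans ((mul_le_mul_of_nonneg_left (twoLink_sum_sq_le hx k a e) (by norm_num)).trans hρ)

/-- total chart size of the two-link point: `Σ_e Σ_c gn(chartSU2 v₀(e))_c² ≤ (8/3)a²`. [folklore] -/
theorem twoLink_chart_sum_sum_sq_le {x₁ x₂ : Site 3 L} (hx : x₁ ≠ x₂) (k : Fin 3) {a : ℝ} (ha : |a| ≤ 1 / 2) :
    ∑ e, ∑ c, gnLink (chartSU2 ((Pi.single (x₁, k) (Pi.single (0 : Fin 3) a) - Pi.single (x₂, k) (Pi.single (0 : Fin 3) a) : Edge 3 L → Fin 3 → ℝ) e)) c ^ 2 ≤ 8 / 3 * a ^ 2 := by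
  have h1 : ∑ e, ∑ c, gnLink (chartSU2 ((Pi.single (x₁, k) (Pi.single (0 : Fin 3) a) - Pi.single (x₂, k) (Pi.single (0 : Fin 3) a) : Edge 3 L → Fin 3 → ℝ) e)) c ^ 2 ≤ ∑ e, 4 / 3 * ∑ c, (Pi.single (x₁, k) (Pi.single (0 : Fin 3) a) - Pi.single (x₂, k) (Pi.single (0 : Fin 3) a) : Edge 3 L → Fin 3 → ℝ) e c ^ 2 :=
    Finset.sum_le_sum fun e _ => twoLink_chart_sum_sq_le hx k ha e
  have h2 : ∑ e, 4 / 3 * ∑ c, (Pi.single (x₁, k) (Pi.single (0 : Fin 3) a) - Pi.single (x₂, k) (Pi.single (0 : Fin 3) a) : Edge 3 L → Fin 3 → ℝ) e c ^ 2 = 8 / 3 * a ^ 2 := by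
    rw [← Finset.mul_sum, twoLink_sum_sum_sq hx k a]; ring
  exact h1.trans h2.le

/-- `‖chartVec w‖² = Σ_e Σ_c w_e c²` at the two-link chart point. [folklore] -/
theorem twoLink_chart_norm_sq {x₁ x₂ : Site 3 L} (k : Fin 3) (a : ℝ) :
    ‖chartVec (fun e => gnLink (chartSU2 ((Pi.single (x₁, k) (Pi.single (0 : Fin 3) a) - Pi.single (x₂, k) (Pi.single (0 : Fin 3) a) : Edge 3 L → Fin 3 → ℝ) e)))‖ ^ 2 = ∑ e, ∑ c, gnLink (chartSU2 ((Pi.single (x₁, k) (Pi.single (0 : Fin 3) a) - Pi.single (x₂, k) (Pi.single (0 : Fin 3) a) : Edge 3 L → Fin 3 → ℝ) e)) c ^ 2 := by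
  have h0 := sum_sub_sq_eq_norm_chartVec_sub L (fun e => gnLink (chartSU2 ((Pi.single (x₁, k) (Pi.single (0 : Fin 3) a) - Pi.single (x₂, k) (Pi.single (0 : Fin 3) a) : Edge 3 L → Fin 3 → ℝ) e))) 0
  have hz : chartVec (0 : Edge 3 L → Fin 3 → ℝ) = 0 := by
    have h := chartVec_sub L (0 : Edge 3 L → Fin 3 → ℝ) 0
    rwa [sub_self, sub_self] at h
  simp only [Pi.zero_apply, sub_zero, hz] at h0
  exact h0.symm

/-- ★ … and in the localisation ball `‖chartVec w‖ ≤ R₁` as soon as `(8/3)a² ≤ R₁²` (`R₁ ≥ 0`, `|a| ≤ 1/2`). [folklore] -/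
theorem twoLink_chart_norm_le {x₁ x₂ : Site 3 L} (hx : x₁ ≠ x₂) (k : Fin 3) {a : ℝ} (ha : |a| ≤ 1 / 2) {R₁ : ℝ} (hR₁ : 0 ≤ R₁) (hR : 8 / 3 * a ^ 2 ≤ R₁ ^ 2) :
    ‖chartVec (fun e => gnLink (chartSU2 ((Pi.single (x₁, k) (Pi.single (0 : Fin 3) a) - Pi.single (x₂, k) (Pi.single (0 : Fin 3) a) : Edge 3 L → Fin 3 → ℝ) e)))‖ ≤ R₁ := by
  have hsq : ‖chartVec (fun e => gnLink (chartSU2 ((Pi.single (x₁, k) (Pi.single (0 : Fin 3) a) - Pi.single (x₂, k) (Pi.single (0 : Fin 3) a) : Edge 3 L → Fin 3 → ℝ) e)))‖ ^ 2 ≤ 8 / 3 * a ^ 2 :=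
    (twoLink_chart_norm_sq k a).le.trans (twoLink_chart_sum_sum_sq_le hx k ha)
  nlinarith [norm_nonneg (chartVec (fun e => gnLink (chartSU2 ((Pi.single (x₁, k) (Pi.single (0 : Fin 3) a) - Pi.single (x₂, k) (Pi.single (0 : Fin 3) a) : Edge 3 L → Fin 3 → ℝ) e)))), hsq, hR, hR₁]

omit [NeZero L] in
/-- ★ `orthoTube L 1 v₀ = P(gn ∘ chartSU2 ∘ v₀)`: the two-link configuration IS a chart point (`|a| ≤ 1/2`). [folklore] -/
theorem orthoTube_twoLink_eq_chart {x₁ x₂ : Site 3 L} (hx : x₁ ≠ x₂) (k : Fin 3) {a : ℝ} (ha : |a| ≤ 1 / 2) :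
    orthoTube L 1 (Pi.single (x₁, k) (Pi.single (0 : Fin 3) a) - Pi.single (x₂, k) (Pi.single (0 : Fin 3) a) : Edge 3 L → Fin 3 → ℝ) = latPatternChart L (fun _ => false) (fun e => gnLink (chartSU2 ((Pi.single (x₁, k) (Pi.single (0 : Fin 3) a) - Pi.single (x₂, k) (Pi.single (0 : Fin 3) a) : Edge 3 L → Fin 3 → ℝ) e))) :=
  orthoTube_one_eq_latPatternChart (twoLink_cap hx k ha)

/-! ## §4 ★★★ The localised lower Gaussian hypothesis is false beyond the two-link radius -/

/-- ★★★ **Two-link obstruction to (C1c′)-lower, explicit amplitude.**  Under the support hypotheses of the (C1) glue (`Ω(linkEmbed v) ≠ 0 ⇒ |v_{e,c}| ≤ T₁`,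
`W g ≠ 0 ⇒ ‖g_x − 1‖ ≤ T₂`) and the lower half `mc·G ≤ A_W(χ₀⊗Ω)` of a pointwise comparison with `mc > 0` (for `G := A_W(χ₀⊗Ω)` take `mc = 1`), NO `gm > 0` satisfies
`gm·e^{−q(chartVec w)} ≤ G(P w)` on `{∀ e, Σ_c w_e c² ≤ ρ²} ∩ {‖chartVec w‖ ≤ R₁}` once an amplitude `a` with `3T₁ + 2T₂ < |a| ≤ 1/2`, `(4/3)a² ≤ ρ²`, `(8/3)a² ≤ R₁²` exists:
the two-link configuration is such a chart point and `A_W(χ₀⊗Ω)` vanishes there (`R45.smearedBO_twoLink_eq_zero`). [folklore] -/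
theorem not_localGaussLower_of_twoLink {Ω : LinkSpace L → ℝ} {W : (Site 3 L → SU2) → ℝ} {T₁ T₂ : ℝ}
    (hΩt : ∀ v : Edge 3 L → Fin 3 → ℝ, Ω (linkEmbed L v) ≠ 0 → ∀ e c, |v e c| ≤ T₁)
    (hWc : ∀ g : Site 3 L → SU2, W g ≠ 0 → ∀ x, ‖su2Quat (g x) - 1‖ ≤ T₂)
    (χ₀ : GaugeConfig 3 1 SU2 → ℝ) {x₁ x₂ : Site 3 L} (hx : x₁ ≠ x₂) (k : Fin 3) {a : ℝ} (ha : |a| ≤ 1 / 2) (hbig : 3 * T₁ + 2 * T₂ < |a|)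
    {ρ R₁ : ℝ} (hρa : 4 / 3 * a ^ 2 ≤ ρ ^ 2) (hR₁ : 0 ≤ R₁) (hR₁a : 8 / 3 * a ^ 2 ≤ R₁ ^ 2)
    {G : GaugeConfig 3 L SU2 → ℝ} {mc : ℝ} (hmc : 0 < mc)
    (hC1c : ∀ V, mc * G V ≤ ∫ g, W g * boFun L χ₀ Ω (gaugeTransform g⁻¹ V) ∂gaugeMeasure L) {β gm : ℝ} (hgm : 0 < gm) :
    ¬ ∀ w : Edge 3 L → Fin 3 → ℝ, (∀ e, ∑ c, w e c ^ 2 ≤ ρ ^ 2) → ‖chartVec w‖ ≤ R₁ →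
        gm * Real.exp (-stiffGaussExp L (β / 2) β (chartVec w)) ≤ G (latPatternChart L (fun _ => false) w) := by
  intro hlo
  -- (elaboration note: the chart-point facts are named first; applying `hlo` to the explicit lambda inline makes the unifier time out)
  have P := twoLink_chart_mem_ball hx k ha hρa
  have Q := twoLink_chart_norm_le hx k ha hR₁ hR₁a
  have h1 := hlo _ P Q
  rw [← orthoTube_twoLink_eq_chart hx k ha] at h1
  have hA := smearedBO_twoLink_eq_zero hΩt hWc χ₀ 1 hx k ha hbig
  have hG : G (orthoTube L 1 (Pi.single (x₁, k) (Pi.single (0 : Fin 3) a) - Pi.single (x₂, k) (Pi.single (0 : Fin 3) a) : Edge 3 L → Fin 3 → ℝ)) ≤ 0 := G_nonpos_of_hC1c_at hmc (hC1c _) hA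
  exact lt_irrefl (0 : ℝ) ((mul_pos hgm (Real.exp_pos _)).trans_le (h1.trans hG))

/-- ★★★ **In the parameters of `…BOCentralTube.central_transfer_two_sided_of_localisedAvg`** (one support scale `T ≥ 0` for `Ω` and `W`, chart radius `0 < ρ ≤ 1/2` with
`8T ≤ ρ`, localisation radius `R₁ ≥ 0`): its hypothesis `hAlo` — for `G` with `mc·G ≤ A_W(χ₀⊗Ω)`, `mc > 0`, e.g. `G := A_W(χ₀⊗Ω)` — is FALSE for every `gm > 0` as soon as
`R₁² > (200/3)·T²` (`R₁ > 8.165·T`).  (Amplitude `a² = min(3ρ²/4, 3R₁²/8)`.) [folklore] -/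
theorem not_hAlo_of_sq_lt {Ω : LinkSpace L → ℝ} {W : (Site 3 L → SU2) → ℝ} {T : ℝ} (hT0 : 0 ≤ T)
    (hΩt : ∀ v : Edge 3 L → Fin 3 → ℝ, Ω (linkEmbed L v) ≠ 0 → ∀ e c, |v e c| ≤ T)
    (hWc : ∀ g : Site 3 L → SU2, W g ≠ 0 → ∀ x, ‖su2Quat (g x) - 1‖ ≤ T)
    (χ₀ : GaugeConfig 3 1 SU2 → ℝ) {x₁ x₂ : Site 3 L} (hx : x₁ ≠ x₂) (k : Fin 3)
    {ρ R₁ : ℝ} (hρ : 0 < ρ) (hρ2 : ρ ≤ 1 / 2) (hTρ : 8 * T ≤ ρ) (hR₁ : 0 ≤ R₁) (hR₁T : 200 / 3 * T ^ 2 < R₁ ^ 2)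
    {G : GaugeConfig 3 L SU2 → ℝ} {mc : ℝ} (hmc : 0 < mc)
    (hC1c : ∀ V, mc * G V ≤ ∫ g, W g * boFun L χ₀ Ω (gaugeTransform g⁻¹ V) ∂gaugeMeasure L) {β gm : ℝ} (hgm : 0 < gm) :
    ¬ ∀ w : Edge 3 L → Fin 3 → ℝ, (∀ e, ∑ c, w e c ^ 2 ≤ ρ ^ 2) → ‖chartVec w‖ ≤ R₁ →
        gm * Real.exp (-stiffGaussExp L (β / 2) β (chartVec w)) ≤ G (latPatternChart L (fun _ => false) w) := by
  obtain ⟨a, ha0, ha2⟩ : ∃ a : ℝ, 0 ≤ a ∧ a ^ 2 = min (3 / 4 * ρ ^ 2) (3 / 8 * R₁ ^ 2) :=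
    ⟨Real.sqrt _, Real.sqrt_nonneg _, Real.sq_sqrt (le_min (by positivity) (by positivity))⟩
  have hM1 : a ^ 2 ≤ 3 / 4 * ρ ^ 2 := by rw [ha2]; exact min_le_left _ _
  have hM2 : a ^ 2 ≤ 3 / 8 * R₁ ^ 2 := by rw [ha2]; exact min_le_right _ _
  have habs : |a| = a := abs_of_nonneg ha0
  have ha : |a| ≤ 1 / 2 := by
    rw [habs]; nlinarith [mul_nonneg (sub_nonneg.2 hρ2) hρ.le]
  have h25 : 25 * T ^ 2 < 3 / 4 * ρ ^ 2 := by
    nlinarith [mul_nonneg (sub_nonneg.2 hTρ) hρ.le, mul_nonneg (sub_nonneg.2 hTρ) hT0, mul_pos hρ hρ, sq_nonneg T]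
  have hlt : 25 * T ^ 2 < a ^ 2 := by rw [ha2]; exact lt_min h25 (by linarith)
  have hbig : 3 * T + 2 * T < |a| := by
    rw [habs]; nlinarith [hlt, hT0, ha0]
  exact not_localGaussLower_of_twoLink hΩt hWc χ₀ hx k ha hbig (by linarith [hM1]) hR₁ (by linarith [hM2]) hmc hC1c hgm

/-- ★★ Corollary: the UNLOCALISED lower hypothesis `hGlo` of `…BOCentralGaussian.central_gaussian_lower` (whole chart polydisc) is false for every `G` with
`mc·G ≤ A_W(χ₀⊗Ω)`, `mc > 0`, and every `gm > 0`, under `0 ≤ T`, `8T ≤ ρ ≤ 1/2` alone. [folklore] -/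
theorem not_hGlo {Ω : LinkSpace L → ℝ} {W : (Site 3 L → SU2) → ℝ} {T : ℝ} (hT0 : 0 ≤ T)
    (hΩt : ∀ v : Edge 3 L → Fin 3 → ℝ, Ω (linkEmbed L v) ≠ 0 → ∀ e c, |v e c| ≤ T)
    (hWc : ∀ g : Site 3 L → SU2, W g ≠ 0 → ∀ x, ‖su2Quat (g x) - 1‖ ≤ T)
    (χ₀ : GaugeConfig 3 1 SU2 → ℝ) {x₁ x₂ : Site 3 L} (hx : x₁ ≠ x₂) (k : Fin 3)
    {ρ : ℝ} (hρ : 0 < ρ) (hρ2 : ρ ≤ 1 / 2) (hTρ : 8 * T ≤ ρ)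
    {G : GaugeConfig 3 L SU2 → ℝ} {mc : ℝ} (hmc : 0 < mc)
    (hC1c : ∀ V, mc * G V ≤ ∫ g, W g * boFun L χ₀ Ω (gaugeTransform g⁻¹ V) ∂gaugeMeasure L) {β gm : ℝ} (hgm : 0 < gm) :
    ¬ ∀ w : Edge 3 L → Fin 3 → ℝ, (∀ e, ∑ c, w e c ^ 2 ≤ ρ ^ 2) →
        gm * Real.exp (-stiffGaussExp L (β / 2) β (chartVec w)) ≤ G (latPatternChart L (fun _ => false) w) := fun h =>
  not_hAlo_of_sq_lt hT0 hΩt hWc χ₀ hx k hρ hρ2 hTρ (R₁ := 9 * T + 1) (by positivity) (by nlinarith [sq_nonneg T]) hmc hC1c hgm fun w hw _ => h w hw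

/-! ## §5 ★★ The window left for (C1) via `…BOCentralTube` with `G := A_W(χ₀⊗Ω)` -/

/-- ★★ **Window.**  In the parameters of `…BOCentralTube.central_transfer_two_sided_of_localisedAvg` (`0 ≤ T`, `8T ≤ ρ`, `0 ≤ R`, `2R ≤ R₁`, `β > 0`): if `hAlo` holds with
some `gm > 0` — so `R₁² ≤ (200/3)T²` by `not_hAlo_of_sq_lt` — and the lower constant `m_d` is informative — so `min(ρ−2T, R₁−2R)²β > |E×3|·log 2 + 98βR²` by
`central_gaussian_tube_lower_nonpos` — then `102R² < R₁² ≤ (200/3)T²` (the declared fibre-norm bound is below `0.81×` the declared component/gauge bound) and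
`9L³·log 2 < (200/3)·T²·β` (`T > 0.30·L^{3/2}·β^{-1/2}`). [folklore] -/
theorem window {β ρ T R R₁ : ℝ} (hβ : 0 < β) (hT0 : 0 ≤ T) (hTρ : 8 * T ≤ ρ) (hR0 : 0 ≤ R) (hR₁ : 2 * R ≤ R₁)
    (hinfo : Fintype.card (Edge 3 L × Fin 3) * Real.log 2 + 98 * β * R ^ 2 < (min (ρ - 2 * T) (R₁ - 2 * R)) ^ 2 * β)
    (hAlo : R₁ ^ 2 ≤ 200 / 3 * T ^ 2) :
    102 * R ^ 2 < R₁ ^ 2 ∧ R₁ ^ 2 ≤ 200 / 3 * T ^ 2 ∧ 9 * (L : ℝ) ^ 3 * Real.log 2 < 200 / 3 * T ^ 2 * β := by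
  have hc0 : 0 ≤ (Fintype.card (Edge 3 L × Fin 3) : ℝ) * Real.log 2 := mul_nonneg (Nat.cast_nonneg _) (Real.log_nonneg one_le_two)
  have h1 : 0 ≤ ρ - 2 * T := by linarith
  have h2 : 0 ≤ R₁ - 2 * R := by linarith
  have hmin : (min (ρ - 2 * T) (R₁ - 2 * R)) ^ 2 ≤ (R₁ - 2 * R) ^ 2 := pow_le_pow_left₀ (le_min h1 h2) (min_le_right _ _) 2
  have hA : Fintype.card (Edge 3 L × Fin 3) * Real.log 2 + 98 * β * R ^ 2 < (R₁ - 2 * R) ^ 2 * β :=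
    hinfo.trans_le (mul_le_mul_of_nonneg_right hmin hβ.le)
  have h98 : 98 * R ^ 2 < (R₁ - 2 * R) ^ 2 := by
    by_contra h
    push Not at h
    have := mul_le_mul_of_nonneg_right h hβ.le
    linarith
  have h5 : 0 ≤ 98 * β * R ^ 2 := by positivity
  refine ⟨by nlinarith [h98, mul_nonneg hR0 h2], hAlo, ?_⟩
  rw [← card_mul_log_two (L := L)]
  have h3 : (R₁ - 2 * R) ^ 2 * β ≤ R₁ ^ 2 * β := mul_le_mul_of_nonneg_right (by nlinarith [mul_nonneg hR0 h2]) hβ.le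
  have h4 : R₁ ^ 2 * β ≤ 200 / 3 * T ^ 2 * β := mul_le_mul_of_nonneg_right hAlo hβ.le
  linarith

end Summit.QuantumFields.YangMills.Theorems.TwistedTraceScaling.Negative.R46

end
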